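import Summits.Langlands.Langlands.Theses.SkinnerWilesDefectOne
import Summits.Langlands.Langlands.Theorems.SkinnerWilesDefectOneProModularOrdinaryClassicalGivenBianchiFiniteness
import Summits.Langlands.Langlands.Theorems.SkinnerWilesDefectOneBianchiCongruenceCohomologyFinite
import Literature.NumberTheory.Automorphic.BianchiBoundaryEigensystemReducible
import HarnessLib

/-!
# Route `SkinnerWilesDefectOne`, crux `ProModularOrdinaryClassical` (stmt-Langlands-12921): the SPLIT GLUE
# `OrdinaryFactorisationIwahoriNonCM → CmInducedClassical → OrdinarilyProModularOrdinaryClassical → ProModularOrdinaryClassical`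

Helper file (`--supports stmt-Langlands-12921`; crux-strategist decomposition, BC2 redirect of the route re-audit
2026-08-17).  The exit crux `ProModularOrdinaryClassical` (every irreducible, a.e. unramified, `p`-adically automorphic,
Galois-ordinary parallel-weight `ρ : Γ_F → GL₂(ℚ̄_p)` over an imaginary quadratic `F` is classical) is cut into THREE
typed pieces along the seams the eight lead seats of the line `top-degree-exact-control` isolated:

* `X₁ = OrdinaryFactorisationIwahoriNonCM` (crux; OPEN — ordinary local–global compatibility for completed cohomology of
  `GL₂/F` in the Galois ⇒ Hecke direction, Hansen 2017 Conj. 1.2.3 / Khare–Thorne 2017 Conj. 6.18 at `n = 2`, slope `0`):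
  for NON-CM `ρ`, pro-modular + Galois-ordinary of parallel weight `k ≥ 2` ⇒ a continuous slope-zero point of the
  Iwahori-tower big Hecke algebra `𝕋^S(𝒰; p)` at a tame level maximal above `p`, associated with `ρ`, with finite-order
  slot-`0` diamond character (the registered stub `stub_ordinaryFactorisationIwahoriNonCM`, VERBATIM);
* `X₂ = CmInducedClassical` (support; theorem in print — Arthur–Clozel Ch. 3 Thm. 6.2 / Lemma 6.4, Henniart 2012): a `ρ`
  whose Frobenius polynomials are a.e. those induced from a regular algebraic Hecke character `θ` of a quadratic `K/F`
  (through `ι`) corresponds a.e. to an L-algebraic CUSPIDAL `π` of `GL₂(𝔸_F)`;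
* `X₃ = OrdinarilyProModularOrdinaryClassical` (support; theorem in print — Hida 1993/94 control, Harder 1987
  Eichler–Shimura + boundary, Khare–Thorne 2017 §6): Skinner–Wiles' own exit (SW99 Prop. 3.7 shape): an irreducible `ρ`
  associated with a continuous point of Hida's ORDINARY big Hecke algebra `𝕋^{S,ord}(𝒰)` (`𝒰` maximal above `p`,
  finite-order slot `0`) and Galois-ordinary of parallel weight `k ≥ 2` is classical.

`ProModularOrdinaryClassical_of_subs : X₁ → X₂ → X₃ → ProModularOrdinaryClassical` is PROVED here (no named fact
consumed): case split on the CM shape of `ρ` through `ι`; (CM) `X₂` directly; (non-CM) `X₁` gives a slope-zero Iwahori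
point `y`, the LANDED Khare–Thorne Lemma 2.10 `stub_slopeZeroFactorisation` (p98105) — fed with the finiteness of the
Hida tower's `ℤ/p^s`-cohomology, which is the PROVED route item `BianchiCongruenceCohomologyFinite`
(`BianchiCongruenceCohomologyFinite_proof`, p-landed 2026-08-16) through the landed Shapiro rewiring
`hidaCohomology_finite_of_bianchi` (p112149) — factors `y = x ∘ toOrd` through `𝕋^{S,ord}(𝒰)`; association and the
diamond values transport along `toOrd` (`toOrd_hidaT`, `toOrd_hidaDiamond`); then `X₃`.  Two certificates record that
`X₂` and `X₃` are literature debt, not open mathematics: `cmInducedClassical_of_two_facts` (= p112953 ∘ p106683) and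
`ordinarilyProModularOrdinaryClassical_of_two_facts` (= p96987 with its third printed input, reducibility of boundary
eigensystems, DISCHARGED by the tree's `bianchi_boundaryEigensystem_isReducible_holds`).  Pure logic over landed files; no
definitions; the three hypotheses are written UNFOLDED (the children's one-line Props byte-for-byte), so that after the
split the gate's glue item `ProModularOrdinaryClassicalOfSubs` closes by `exact ProModularOrdinaryClassical_of_subs`.
-/

set_option linter.dupNamespace false

noncomputable section

namespace Summit.Langlands.Langlands.Theorems.SkinnerWilesDefectOne.ExitSplit

open Summit.Langlands.Langlands.Theses.SkinnerWilesDefectOne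
open Summit.Langlands.Langlands.Cruxes.ProModularOrdinaryClassical.TopDegreeExactControl
open Summit.Langlands.Langlands.Theorems.SkinnerWilesDefectOne.BianchiFiniteness
open Summit.Langlands.Langlands.Theorems.SkinnerWilesDefectOne.GivenBianchiFiniteness
open Literature.NumberTheory.Automorphic Literature.NumberTheory.GaloisRepresentations
open Literature.NumberTheory.Automorphic.BigHeckeGLn
open NumberField IsDedekindDomain Filter Polynomial
open scoped Classical

/-- **The split glue** `X₁ → X₂ → X₃ → ProModularOrdinaryClassical` (children unfolded): case split on the CM shape of
`ρ`; CM ⇒ `X₂`; non-CM ⇒ `X₁` + Khare–Thorne Lemma 2.10 (landed `stub_slopeZeroFactorisation`, finiteness from the PROVED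
item `BianchiCongruenceCohomologyFinite`) + transport along `toOrd` ⇒ the hypotheses of `X₃`. [folklore] -/
theorem ProModularOrdinaryClassical_of_subs :
    (∀ (F : Type) [Field F] [NumberField F], NumberField.IsTotallyComplex F → Module.finrank ℚ F = 2 → ∀ (p : ℕ) [Fact p.Prime], p ≠ 2 → ∀ (ι : PadicAlgCl p ≃+* ℂ) (ρ : Literature.NumberTheory.GaloisRepresentations.FramedGaloisRep F (PadicAlgCl p) 2) (k m : ℕ), ρ.toGaloisRep.IsIrreducible → (¬ ∃ (K : Type) (_ : Field K) (_ : NumberField K) (_ : Algebra F K) (_ : Module.finrank F K = 2) (θ : Literature.NumberTheory.GaloisRepresentations.HeckeCharacter K), θ.IsAlgebraic ∧ (∃ᶠ w : IsDedekindDomain.HeightOneSpectrum (NumberField.RingOfIntegers K) in Filter.cofinite, ∃ w' : IsDedekindDomain.HeightOneSpectrum (NumberField.RingOfIntegers K), w'.asIdeal.under (NumberField.RingOfIntegers F) = w.asIdeal.under (NumberField.RingOfIntegers F) ∧ θ.valueAtUniformizer w' ≠ θ.valueAtUniformizer w) ∧ ∀ᶠ v : IsDedekindDomain.HeightOneSpectrum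 (NumberField.RingOfIntegers F) in Filter.cofinite, ρ.IsUnramifiedAt v ∧ ρ.HasFrobCharpolyAt v (∏ᶠ w ∈ {w : IsDedekindDomain.HeightOneSpectrum (NumberField.RingOfIntegers K) | w.under (NumberField.RingOfIntegers F) = v}, (Polynomial.X ^ w.asIdeal.inertiaDeg (NumberField.RingOfIntegers F) - Polynomial.C (ι.symm (θ.valueAtUniformizer w)⁻¹)))) → (∀ᶠ v in Filter.cofinite, ρ.IsUnramifiedAt v) → (∃ 𝒰 : Literature.NumberTheory.Automorphic.BigHeckeGLn.TameLevel 2 F p, 𝒰.IsPadicallyAutomorphic ρ) → 2 ≤ k → 0 < m → (∀ v : IsDedekindDomain.HeightOneSpectrum (NumberField.RingOfIntegers F), (p : NumberField.RingOfIntegers F) ∈ v.asIdeal → ρ.IsOrdinaryOfWeightAt p v k m) → ∃ 𝒰 : Literature.NumberTheory.Automorphic.BigHeckeGLn.TameLevel 2 F p, 𝒰.IsMaximalAbove ∧ ∃ y : Literature.NumberTheory.Automorphic.HidaHeckeAlgebraGLn 𝒰 →+* PadicAlgCl p, Continuous y ∧ 𝒰.IsHidaAssociated y ρ ∧ (∀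 v : IsDedekindDomain.HeightOneSpectrum (NumberField.RingOfIntegers F), (p : NumberField.RingOfIntegers F) ∈ v.asIdeal → 𝒰.IsSlopeZeroAt y v) ∧ ∃ N : ℕ, 0 < N ∧ ∀ (u : NumberField.RingOfIntegers F) (û : ∀ v : IsDedekindDomain.HeightOneSpectrum (NumberField.RingOfIntegers F), (p : NumberField.RingOfIntegers F) ∈ v.asIdeal → (v.adicCompletionIntegers F)ˣ), (∀ (v : IsDedekindDomain.HeightOneSpectrum (NumberField.RingOfIntegers F)) (hv : (p : NumberField.RingOfIntegers F) ∈ v.asIdeal), ((û v hv : v.adicCompletionIntegers F) : v.adicCompletion F) = algebraMap F (v.adicCompletion F) (u : F)) → (∏ᶠ v : {v : IsDedekindDomain.HeightOneSpectrum (NumberField.RingOfIntegers F) // (p : NumberField.RingOfIntegers F) ∈ v.asIdeal}, y (𝒰.hidaDiamond v.2 (Pi.mulSingle (0 : Fin 2) (û v.1 v.2)))) ^ N = 1) →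
    (∀ (F : Type) [Field F] [NumberField F] (p : ℕ) [Fact p.Prime] (hcpt : Literature.NumberTheory.Automorphic.isCompact_glFiniteIntegralLevel 2 F) (ι : PadicAlgCl p ≃+* ℂ) (ρ : Literature.NumberTheory.GaloisRepresentations.FramedGaloisRep F (PadicAlgCl p) 2), (∃ (K : Type) (_ : Field K) (_ : NumberField K) (_ : Algebra F K) (_ : Module.finrank F K = 2) (θ : Literature.NumberTheory.GaloisRepresentations.HeckeCharacter K), θ.IsAlgebraic ∧ (∃ᶠ w : IsDedekindDomain.HeightOneSpectrum (NumberField.RingOfIntegers K) in Filter.cofinite, ∃ w' : IsDedekindDomain.HeightOneSpectrum (NumberField.RingOfIntegers K), w'.asIdeal.under (NumberField.RingOfIntegers F) = w.asIdeal.under (NumberField.RingOfIntegers F) ∧ θ.valueAtUniformizer w' ≠ θ.valueAtUniformizer w) ∧ ∀ᶠ v : IsDedekindDomain.HeightOneSpectrum (NumberField.RingOfIntegers F) in Filter.cofinite, ρ.IsUnramifiedAt v ∧ ρ.HasFrobCharpolyAt v (∏ᶠ w ∈ {w : IsDedekindDomain.HeightOneSpectrum (NumberField.RingOfIntegers K)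 | w.under (NumberField.RingOfIntegers F) = v}, (Polynomial.X ^ w.asIdeal.inertiaDeg (NumberField.RingOfIntegers F) - Polynomial.C (ι.symm (θ.valueAtUniformizer w)⁻¹)))) → ∃ π : Literature.NumberTheory.Automorphic.CuspidalAutomorphicRepData 2 F hcpt, π.1.IsLAlgebraic ∧ ∀ᶠ v in Filter.cofinite, Summit.Langlands.SatakeFrobCompatibleAt ι π.1 ρ v) →
    (∀ (F : Type) [Field F] [NumberField F], NumberField.IsTotallyComplex F → Module.finrank ℚ F = 2 → ∀ (p : ℕ) [Fact p.Prime], p ≠ 2 → ∀ (hcpt : Literature.NumberTheory.Automorphic.isCompact_glFiniteIntegralLevel 2 F) (ι : PadicAlgCl p ≃+* ℂ) (ρ : Literature.NumberTheory.GaloisRepresentations.FramedGaloisRep F (PadicAlgCl p) 2), ρ.toGaloisRep.IsIrreducible → (∃ 𝒰 : Literature.NumberTheory.Automorphic.BigHeckeGLn.TameLevel 2 F p, 𝒰.IsMaximalAbove ∧ ∃ x : Literature.NumberTheory.Automorphic.OrdinaryHeckeAlgebraGLn 𝒰 →+* PadicAlgCl p, Continuous x ∧ 𝒰.IsOrdAssociated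 x ρ ∧ ∃ N : ℕ, 0 < N ∧ ∀ (u : NumberField.RingOfIntegers F) (û : ∀ v : IsDedekindDomain.HeightOneSpectrum (NumberField.RingOfIntegers F), (p : NumberField.RingOfIntegers F) ∈ v.asIdeal → (v.adicCompletionIntegers F)ˣ), (∀ (v : IsDedekindDomain.HeightOneSpectrum (NumberField.RingOfIntegers F)) (hv : (p : NumberField.RingOfIntegers F) ∈ v.asIdeal), ((û v hv : v.adicCompletionIntegers F) : v.adicCompletion F) = algebraMap F (v.adicCompletion F) (u : F)) → (∏ᶠ v : {v : IsDedekindDomain.HeightOneSpectrum (NumberField.RingOfIntegers F) // (p : NumberField.RingOfIntegers F) ∈ v.asIdeal}, x (𝒰.ordDiamond v.2 (Pi.mulSingle (0 : Fin 2) (û v.1 v.2)))) ^ N = 1) → (∃ k : ℕ, 2 ≤ k ∧ ∃ m : ℕ, 0 < m ∧ ∀ v : IsDedekindDomain.HeightOneSpectrum (NumberField.RingOfIntegers F), (p : NumberField.RingOfIntegers F) ∈ v.asIdeal → ρ.IsOrdinaryOfWeightAt p v k m) → ∃ π : Literature.NumberTheory.Automorphic.CuspidalAutomorphicRepData 2 F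 hcpt, π.1.IsLAlgebraic ∧ ∀ᶠ v in Filter.cofinite, Summit.Langlands.SatakeFrobCompatibleAt ι π.1 ρ v) →
    ProModularOrdinaryClassical := by
  intro hOF hCM hOrd F _ _ hF hdeg p _ hp hcpt ι ρ hirr hunr hpm hord
  by_cases hcm : ∃ (K : Type) (_ : Field K) (_ : NumberField K) (_ : Algebra F K) (_ : Module.finrank F K = 2) (θ : Literature.NumberTheory.GaloisRepresentations.HeckeCharacter K), θ.IsAlgebraic ∧ (∃ᶠ w : IsDedekindDomain.HeightOneSpectrum (NumberField.RingOfIntegers K) in Filter.cofinite, ∃ w' : IsDedekindDomain.HeightOneSpectrum (NumberField.RingOfIntegers K), w'.asIdeal.under (NumberField.RingOfIntegers F) = w.asIdeal.under (NumberField.RingOfIntegers F) ∧ θ.valueAtUniformizer w' ≠ θ.valueAtUniformizer w) ∧ ∀ᶠ v : IsDedekindDomain.HeightOneSpectrum (NumberField.RingOfIntegers F) in Filter.cofinite, ρ.IsUnramifiedAt v ∧ ρ.HasFrobCharpolyAt v (∏ᶠ w ∈ {w : IsDedekindDomain.HeightOneSpectrum (NumberField.RingOfIntegers K) | w.under (NumberField.RingOfIntegers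 F) = v}, (Polynomial.X ^ w.asIdeal.inertiaDeg (NumberField.RingOfIntegers F) - Polynomial.C (ι.symm (θ.valueAtUniformizer w)⁻¹)))
  · -- the CM regime: child 2, no pro-modularity / ordinarity used
    exact hCM F p hcpt ι ρ hcm
  · -- the non-CM regime: child 1 ⇒ slope-zero Iwahori point; KT 2.10 with PROVED Bianchi finiteness; transport; child 3
    obtain ⟨k, hk, m, hm, hv⟩ := hord
    obtain ⟨𝒰, h𝒰, y, hy, hass, hslope, N, hN, hslot⟩ :=
      hOF F hF hdeg p hp ι ρ k m hirr hcm hunr hpm hk hm hv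
    have hfin : ∀ x : TowerIndex, Finite (𝒰.hidaCohomology ℤ x) :=
      hidaCohomology_finite_of_bianchi Summit.Langlands.Langlands.Theorems.BianchiCongruenceCohomologyFinite_proof
        F hdeg hF p 𝒰
    obtain ⟨x, hx, hxy⟩ := stub_slopeZeroFactorisation F p 𝒰 h𝒰 hfin y hy hslope
    have hassx : 𝒰.IsOrdAssociated x ρ := by
      -- association transports along `toOrd` (`toOrd T_{w,j} = T_{w,j}`)
      have hfun : (fun w j => x (𝒰.ordT w j)) = fun w j => y (𝒰.hidaT w j) := by
        funext w j
        rw [← hxy, RingHom.comp_apply, TameLevel.toOrd_hidaT]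
      show IsAssociatedFamily 2 𝒰.bad (fun w j => x (𝒰.ordT w j)) ρ
      rw [hfun]
      exact hass
    have hslotx : ∃ N : ℕ, 0 < N ∧ ∀ (u : 𝓞 F)
        (û : ∀ v : HeightOneSpectrum (𝓞 F), (p : 𝓞 F) ∈ v.asIdeal → (v.adicCompletionIntegers F)ˣ),
        (∀ (v : HeightOneSpectrum (𝓞 F)) (hv : (p : 𝓞 F) ∈ v.asIdeal),
          ((û v hv : v.adicCompletionIntegers F) : v.adicCompletion F) = algebraMap F (v.adicCompletion F) (u : F)) →
        (∏ᶠ v : {v : HeightOneSpectrum (𝓞 F) // (p : 𝓞 F) ∈ v.asIdeal},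
          x (𝒰.ordDiamond v.2 (Pi.mulSingle (0 : Fin 2) (û v.1 v.2)))) ^ N = 1 := by
      refine ⟨N, hN, fun u û hû => ?_⟩
      -- the diamond values transport along `toOrd` (`toOrd ⟨u⟩ = ⟨u⟩`)
      have hdia : ∀ v : {v : HeightOneSpectrum (𝓞 F) // (p : 𝓞 F) ∈ v.asIdeal},
          x (𝒰.ordDiamond v.2 (Pi.mulSingle (0 : Fin 2) (û v.1 v.2))) =
            y (𝒰.hidaDiamond v.2 (Pi.mulSingle (0 : Fin 2) (û v.1 v.2))) := by
        intro v
        rw [← hxy, RingHom.comp_apply, TameLevel.toOrd_hidaDiamond]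
      simp only [hdia]
      exact hslot u û hû
    exact hOrd F hF hdeg p hp hcpt ι ρ hirr ⟨𝒰, h𝒰, x, hx, hassx, hslotx⟩ ⟨k, hk, m, hm, hv⟩

/-- **Certificate: child 2 `CmInducedClassical` is literature debt** — it follows from the two printed automorphic-induction
facts (A) `automorphicInduction_cyclic_cuspidal` (Arthur–Clozel Ch. 3 Thm. 6.2 / Lemma 6.4) and (B)
`Henniart2012_infinityType_of_automorphicInduction`, by the landed `cmInducedCuspidal_of_two_facts` (p112953) and
`stub_cmSatakeFrobGlue` (p106683). [cite: ArthurClozelAMS120, Ch. 3 Thm. 6.2] [cite: Henniart2012, Thm. 3 (i)] -/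
theorem cmInducedClassical_of_two_facts
    (hAI : Literature.NumberTheory.Automorphic.automorphicInduction_cyclic_cuspidal)
    (hHen : Literature.NumberTheory.Automorphic.Henniart2012_infinityType_of_automorphicInduction) :
    ∀ (F : Type) [Field F] [NumberField F] (p : ℕ) [Fact p.Prime] (hcpt : Literature.NumberTheory.Automorphic.isCompact_glFiniteIntegralLevel 2 F) (ι : PadicAlgCl p ≃+* ℂ) (ρ : Literature.NumberTheory.GaloisRepresentations.FramedGaloisRep F (PadicAlgCl p) 2), (∃ (K : Type) (_ : Field K) (_ : NumberField K) (_ : Algebra F K) (_ : Module.finrank F K = 2) (θ : Literature.NumberTheory.GaloisRepresentations.HeckeCharacter K), θ.IsAlgebraic ∧ (∃ᶠ w : IsDedekindDomain.HeightOneSpectrum (NumberField.RingOfIntegers K) in Filter.cofinite, ∃ w' : IsDedekindDomain.HeightOneSpectrum (NumberField.RingOfIntegers K), w'.asIdeal.under (NumberField.RingOfIntegers F) = w.asIdeal.under (NumberField.RingOfIntegers F) ∧ θ.valueAtUniformizer w' ≠ θ.valueAtUniformizer w) ∧ ∀ᶠ v : IsDedekindDomain.HeightOneSpectrum (NumberField.RingOfIntegers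 F) in Filter.cofinite, ρ.IsUnramifiedAt v ∧ ρ.HasFrobCharpolyAt v (∏ᶠ w ∈ {w : IsDedekindDomain.HeightOneSpectrum (NumberField.RingOfIntegers K) | w.under (NumberField.RingOfIntegers F) = v}, (Polynomial.X ^ w.asIdeal.inertiaDeg (NumberField.RingOfIntegers F) - Polynomial.C (ι.symm (θ.valueAtUniformizer w)⁻¹)))) → ∃ π : Literature.NumberTheory.Automorphic.CuspidalAutomorphicRepData 2 F hcpt, π.1.IsLAlgebraic ∧ ∀ᶠ v in Filter.cofinite, Summit.Langlands.SatakeFrobCompatibleAt ι π.1 ρ v := by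
  intro F _ _ p _ hcpt ι ρ hcm
  obtain ⟨K, iK, iN, iA, hK, θ, halg, hreg, hfrob⟩ := hcm
  obtain ⟨π, hLalg, hsat⟩ := @cmInducedCuspidal_of_two_facts hAI hHen F _ _ hcpt K iK iN iA hK θ halg hreg
  exact ⟨π, hLalg, @stub_cmSatakeFrobGlue F _ _ p _ hcpt ι ρ K iK iN iA hK θ π hsat hfrob⟩

/-- **Certificate: child 3 `OrdinarilyProModularOrdinaryClassical` is literature debt** — it is, byte for byte, the
conclusion of the landed `ordinarilyProModularOrdinaryClassical` (p96987) after its three printed Bianchi facts, of which the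
third (`bianchi_boundaryEigensystem_isReducible`, Harder 1987) is now a THEOREM of the tree
(`bianchi_boundaryEigensystem_isReducible_holds`); the two remaining inputs are `hidaControl_dominantOrdinaryPoint` (Hida 1994
Thm. 3.2 / Khare–Thorne 2017 §6.4) and `bianchi_interiorEigenclass_isCuspidal` (Harder 1987, Eichler–Shimura–Harder).
[cite: Hida1994AIF, Thm. 3.2] [cite: Harder1987, §3] [cite: KhareThorne2017, §6.5] -/
theorem ordinarilyProModularOrdinaryClassical_of_two_facts
    (hA : Literature.NumberTheory.Automorphic.hidaControl_dominantOrdinaryPoint)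
    (hB : Literature.NumberTheory.Automorphic.bianchi_interiorEigenclass_isCuspidal) :
    ∀ (F : Type) [Field F] [NumberField F], NumberField.IsTotallyComplex F → Module.finrank ℚ F = 2 → ∀ (p : ℕ) [Fact p.Prime], p ≠ 2 → ∀ (hcpt : Literature.NumberTheory.Automorphic.isCompact_glFiniteIntegralLevel 2 F) (ι : PadicAlgCl p ≃+* ℂ) (ρ : Literature.NumberTheory.GaloisRepresentations.FramedGaloisRep F (PadicAlgCl p) 2), ρ.toGaloisRep.IsIrreducible → (∃ 𝒰 : Literature.NumberTheory.Automorphic.BigHeckeGLn.TameLevel 2 F p, 𝒰.IsMaximalAbove ∧ ∃ x : Literature.NumberTheory.Automorphic.OrdinaryHeckeAlgebraGLn 𝒰 →+* PadicAlgCl p, Continuous x ∧ 𝒰.IsOrdAssociated x ρ ∧ ∃ N : ℕ, 0 < N ∧ ∀ (u : NumberField.RingOfIntegers F) (û : ∀ v : IsDedekindDomain.HeightOneSpectrum (NumberField.RingOfIntegers F), (p : NumberField.RingOfIntegers F) ∈ v.asIdeal → (v.adicCompletionIntegers F)ˣ), (∀ (v : IsDedekindDomain.HeightOneSpectrum (NumberField.RingOfIntegers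 F)) (hv : (p : NumberField.RingOfIntegers F) ∈ v.asIdeal), ((û v hv : v.adicCompletionIntegers F) : v.adicCompletion F) = algebraMap F (v.adicCompletion F) (u : F)) → (∏ᶠ v : {v : IsDedekindDomain.HeightOneSpectrum (NumberField.RingOfIntegers F) // (p : NumberField.RingOfIntegers F) ∈ v.asIdeal}, x (𝒰.ordDiamond v.2 (Pi.mulSingle (0 : Fin 2) (û v.1 v.2)))) ^ N = 1) → (∃ k : ℕ, 2 ≤ k ∧ ∃ m : ℕ, 0 < m ∧ ∀ v : IsDedekindDomain.HeightOneSpectrum (NumberField.RingOfIntegers F), (p : NumberField.RingOfIntegers F) ∈ v.asIdeal → ρ.IsOrdinaryOfWeightAt p v k m) → ∃ π : Literature.NumberTheory.Automorphic.CuspidalAutomorphicRepData 2 F hcpt, π.1.IsLAlgebraic ∧ ∀ᶠ v in Filter.cofinite, Summit.Langlands.SatakeFrobCompatibleAt ι π.1 ρ v :=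
  ordinarilyProModularOrdinaryClassical hA hB Literature.NumberTheory.Automorphic.bianchi_boundaryEigensystem_isReducible_holds

/-- **Hence the crux from child 1 and FOUR printed facts** (the smallest trust base recorded so far: cuspidal cyclic automorphic
induction, Henniart's infinity type, Hida control for dominant ordinary points, Eichler–Shimura–Harder for interior Bianchi
eigenclasses) — Borel–Serre finiteness and boundary reducibility being theorems of the tree. [folklore] -/
theorem proModularOrdinaryClassical_of_fourFacts_of_ordinaryFactorisationIwahoriNonCM
    (hAI : Literature.NumberTheory.Automorphic.automorphicInduction_cyclic_cuspidal)
    (hHen : Literature.NumberTheory.Automorphic.Henniart2012_infinityType_of_automorphicInduction)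
    (hA : Literature.NumberTheory.Automorphic.hidaControl_dominantOrdinaryPoint)
    (hB : Literature.NumberTheory.Automorphic.bianchi_interiorEigenclass_isCuspidal)
    (hOF : ∀ (F : Type) [Field F] [NumberField F], NumberField.IsTotallyComplex F → Module.finrank ℚ F = 2 → ∀ (p : ℕ) [Fact p.Prime], p ≠ 2 → ∀ (ι : PadicAlgCl p ≃+* ℂ) (ρ : Literature.NumberTheory.GaloisRepresentations.FramedGaloisRep F (PadicAlgCl p) 2) (k m : ℕ), ρ.toGaloisRep.IsIrreducible → (¬ ∃ (K : Type) (_ : Field K) (_ : NumberField K) (_ : Algebra F K) (_ : Module.finrank F K = 2) (θ : Literature.NumberTheory.GaloisRepresentations.HeckeCharacter K), θ.IsAlgebraic ∧ (∃ᶠ w : IsDedekindDomain.HeightOneSpectrum (NumberField.RingOfIntegers K) in Filter.cofinite, ∃ w' : IsDedekindDomain.HeightOneSpectrum (NumberField.RingOfIntegers K), w'.asIdeal.under (NumberField.RingOfIntegers F) = w.asIdeal.under (NumberField.RingOfIntegers F) ∧ θ.valueAtUniformizer w' ≠ θ.valueAtUniformizer w) ∧ ∀ᶠ v : IsDedekindDomain.HeightOneSpectrum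 (NumberField.RingOfIntegers F) in Filter.cofinite, ρ.IsUnramifiedAt v ∧ ρ.HasFrobCharpolyAt v (∏ᶠ w ∈ {w : IsDedekindDomain.HeightOneSpectrum (NumberField.RingOfIntegers K) | w.under (NumberField.RingOfIntegers F) = v}, (Polynomial.X ^ w.asIdeal.inertiaDeg (NumberField.RingOfIntegers F) - Polynomial.C (ι.symm (θ.valueAtUniformizer w)⁻¹)))) → (∀ᶠ v in Filter.cofinite, ρ.IsUnramifiedAt v) → (∃ 𝒰 : Literature.NumberTheory.Automorphic.BigHeckeGLn.TameLevel 2 F p, 𝒰.IsPadicallyAutomorphic ρ) → 2 ≤ k → 0 < m → (∀ v : IsDedekindDomain.HeightOneSpectrum (NumberField.RingOfIntegers F), (p : NumberField.RingOfIntegers F) ∈ v.asIdeal → ρ.IsOrdinaryOfWeightAt p v k m) → ∃ 𝒰 : Literature.NumberTheory.Automorphic.BigHeckeGLn.TameLevel 2 F p, 𝒰.IsMaximalAbove ∧ ∃ y : Literature.NumberTheory.Automorphic.HidaHeckeAlgebraGLn 𝒰 →+* PadicAlgCl p, Continuous y ∧ 𝒰.IsHidaAssociated y ρ ∧ (∀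 v : IsDedekindDomain.HeightOneSpectrum (NumberField.RingOfIntegers F), (p : NumberField.RingOfIntegers F) ∈ v.asIdeal → 𝒰.IsSlopeZeroAt y v) ∧ ∃ N : ℕ, 0 < N ∧ ∀ (u : NumberField.RingOfIntegers F) (û : ∀ v : IsDedekindDomain.HeightOneSpectrum (NumberField.RingOfIntegers F), (p : NumberField.RingOfIntegers F) ∈ v.asIdeal → (v.adicCompletionIntegers F)ˣ), (∀ (v : IsDedekindDomain.HeightOneSpectrum (NumberField.RingOfIntegers F)) (hv : (p : NumberField.RingOfIntegers F) ∈ v.asIdeal), ((û v hv : v.adicCompletionIntegers F) : v.adicCompletion F) = algebraMap F (v.adicCompletion F) (u : F)) → (∏ᶠ v : {v : IsDedekindDomain.HeightOneSpectrum (NumberField.RingOfIntegers F) // (p : NumberField.RingOfIntegers F) ∈ v.asIdeal}, y (𝒰.hidaDiamond v.2 (Pi.mulSingle (0 : Fin 2) (û v.1 v.2)))) ^ N = 1) :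
    ProModularOrdinaryClassical :=
  ProModularOrdinaryClassical_of_subs hOF (cmInducedClassical_of_two_facts hAI hHen)
    (ordinarilyProModularOrdinaryClassical_of_two_facts hA hB)

end Summit.Langlands.Langlands.Theorems.SkinnerWilesDefectOne.ExitSplit

end
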